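import Mathlib
import HarnessLib
import Summits.AtomisticToContinuum.FouriersLaw.Theorems.VanishingNoiseTransferNoisyFourierFlipCeilingField
import Summits.AtomisticToContinuum.FouriersLaw.Theorems.VanishingNoiseTransferNoisyFourierAbelTransferAux1

/-!
# The Abel transfer: flip sector gap + Kapitza bound ⇒ an `L`-uniform Lipschitz bound of the Green–Kubo
# pairing in the Abel variable (stub `stub_abelTransfer`, line `abel-kapitza-even-corrector`,
# crux `VanishingNoiseTransfer.NoisyFourier`, stmt-AtomisticToContinuum-11977)

`--supports stmt-AtomisticToContinuum-11977` file proving the registered stub `stub_abelTransfer` (part 2; part 1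
is `…NoisyFourierAbelTransferAux1`: sign patterns, reversal, the sector bound).

Setting: the pinned anharmonic chain `𝐏 = pinnedChain ω₂ lam β γ` (all parameters `> 0`), `T > 0`, the Gibbs
measure `μ_T = 𝐏.gibbsMeasure L T`, the flip-noisy equilibrium generator `L_ε = 𝐏.flipGenerator L T T ε`
(`= X_H + γ S_B + ε S`, `S` = Bernardin–Olla's velocity flips, `B = bathWeight`), the total current
`J = Σ_i j_i` and CLASSICAL Abel correctors `u ∈ C² ∩ L²(μ_T)`, `L_ε u = s u − J` pointwise (`s ∈ (0, 1]`).
Hypothesis 1 is the flip sector gap `4‖u − P₀u‖² ≤ E(u) := Σ_i ‖u∘F_i − u‖²` (`P₀` = average over the `2^L`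
momentum-sign patterns), hypothesis 2 the Kapitza bound `‖P₀u‖² ≤ M·L` for correctors. Claim: there is `C`
(independent of `L`, `s`, `s'`) with `|∫ J u dμ_T − ∫ J u' dμ_T| ≤ C (L − 1)|s − s'|` for correctors `u` at `s`,
`u'` at `s'`.

Proof.
1. RESOLVENT IDENTITY (`resolvent_identity`): `∫ J u − ∫ J u' = (s − s') ∫ u · (u'∘Π) dμ_T`, `Π(q,p) = (q,−p)`.
   `u` is a forward pair of the plain equilibrium generator with source `(J − su) + εSu` (`flip_forwardPair`),
   `u'∘Π = rev u'` a backward pair with the reversed source (`Kubo.rev_pair`); the cross Green identity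
   `Kubo.cross` gives `∫ (rev u')((J − su) + εSu) = ∫ u · rev((J − s'u') + εSu')`; the `ε`-terms cancel
   (`S` symmetric under `μ_T`, `S(rev u') = rev(S u')`), `J∘Π = −J` and `μ_T` is `Π`-invariant.
2. ENERGY INEQUALITY (`corrector_energy_le`): `s‖u‖² + (ε/2)E(u) ≤ ∫ u J dμ_T` (`Kubo.fluctuation_dissipation`
   and the flip Dirichlet form `∫ u Su = −E(u)/2`).
3. With the sector bound of part 1 (`|∫ u J| ≤ (δE(u) + LM₁/δ)/4`, `M₁` the `L`-uniform half-current moment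
   bound `gibbsHalfCurrentSqLe`) at `δ = ε`: `E(u) ≤ LM₁/ε²` (`corrector_flipEnergy_le`).
4. `‖u‖² ≤ 2‖P₀u‖² + 2‖u − P₀u‖² ≤ 2ML + E(u)/2`, the same for `u'`, `‖u'∘Π‖ = ‖u'‖`, and Cauchy–Schwarz:
   `|∫ u (u'∘Π)| ≤ 2 max(M,0) L + LM₁/(2ε²) ≤ (L − 1)(4 max(M,0) + M₁/ε²)` for `L ≥ 2`.

References: Bernardin–Olla 2011 §5 (resolvent `(λ − L)⁻¹ j`, the sector decomposition and the symmetric /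
antisymmetric parts of `L` under `Π`), §3 (entropy-production bound); Eckmann–Pillet–Rey-Bellet 1999 §3
(`L* = ΠLΠ`); folklore. No definitions; axioms `propext`, `Classical.choice`, `Quot.sound` only.
-/

noncomputable section

open MeasureTheory Filter Topology
open scoped BigOperators
open Literature.MathematicalPhysics.KineticTheory.HeatConduction
open Summit.AtomisticToContinuum.FouriersLaw.Theorems.SuperadditiveResistance.DeviceLiouville (kin liouvilleOp bathOp)
open Summit.AtomisticToContinuum.FouriersLaw.Theorems.SuperadditiveResistance.Kubo
  (rev rev_apply rev_pair cross fluctuation_dissipation memLp_rev contDiff_rev continuous_source)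
open Summit.AtomisticToContinuum.FouriersLaw.Cruxes.SuperadditiveResistance.InsertionToolbox
  (pinnedChain_memLp_two_of_abs_le)
open Summit.AtomisticToContinuum.FouriersLaw.Theorems.VanishingNoiseBound
  (memLp_comp_momentumFlip memLp_flipNoise flip_forwardPair gibbs_flipInvariant integral_mul_flipNoise_self)
open Summit.AtomisticToContinuum.FouriersLaw.Theorems.NoisyFourier.FlipCeiling (gibbsHalfCurrentSqLe)
open Summit.AtomisticToContinuum.FouriersLaw.Theorems.OddResponseBound.Negative.OddPairing (sq_integral_mul_le)

namespace Summit.AtomisticToContinuum.FouriersLaw.Cruxes.NoisyFourier.AbelKapitzaEvenCorrector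

namespace AbelTransfer

/-! ## Classical Abel correctors of the flip-noisy pinned chain -/

section Chain

variable {ω₂ lam β γ : ℝ}

/-- The total current `J = Σ_i j_i` of the pinned chain is in `L²(μ_T)` (polynomial × Gaussian). [folklore] -/
theorem memLp_totalCurrent (hω : 0 < ω₂) (hl : 0 ≤ lam) (hβ : 0 ≤ β) (γ : ℝ) (L : ℕ) {T : ℝ} (hT : 0 < T) :
    MemLp (fun x => ∑ i, (pinnedChain ω₂ lam β γ).bondCurrent L i x) 2
      ((pinnedChain ω₂ lam β γ).gibbsMeasure L T) := by
  refine memLp_finsetSum _ fun i _ => ?_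
  exact pinnedChain_memLp_two_of_abs_le hω hl hβ γ L hT (pinnedChain_continuous_bondCurrent ω₂ lam β γ L i)
    (C := (L : ℝ) * ((3 + β) / 2)) (k := 2) fun x => by
    calc |(pinnedChain ω₂ lam β γ).bondCurrent L i x|
        ≤ L * ((3 + β) / 2 * (1 + (pinnedChain ω₂ lam β γ).hamiltonian L x) ^ 2) :=
          pinnedChain_abs_bondCurrent_le hω.le hl hβ γ L i x
      _ = (L : ℝ) * ((3 + β) / 2) * (1 + (pinnedChain ω₂ lam β γ).hamiltonian L x) ^ 2 := by ring

/-- **Energy inequality of a classical Abel corrector.** If `u ∈ C² ∩ L²(μ_T)` solves `L_ε u = s u − J`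
pointwise with `J ∈ L²(μ_T)`, then `s‖u‖² + (ε/2) Σ_i ‖u∘F_i − u‖² ≤ ∫ u J dμ_T`: `u` is a forward pair of the
plain equilibrium generator with source `(J − su) + εSu`, fluctuation–dissipation gives `∫ u·source ≥ 0`, and
`∫ u Su = −½ Σ_i ‖u∘F_i − u‖²`. [cite: BernardinOlla2011, §3] -/
theorem corrector_energy_le (hω : 0 < ω₂) (hl : 0 < lam) (hβ : 0 < β) (hγ : 0 < γ) {T : ℝ} (hT : 0 < T)
    (ε : ℝ) {L : ℕ} {s : ℝ} {u J : PhaseSpace L → ℝ} (hJ2 : MemLp J 2 ((pinnedChain ω₂ lam β γ).gibbsMeasure L T))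
    (huC : ContDiff ℝ 2 u) (hu2 : MemLp u 2 ((pinnedChain ω₂ lam β γ).gibbsMeasure L T))
    (hpde : ∀ x, (pinnedChain ω₂ lam β γ).flipGenerator L T T ε u x = s * u x - J x) :
    s * ∫ x, u x ^ 2 ∂((pinnedChain ω₂ lam β γ).gibbsMeasure L T) +
        ε / 2 * ∑ i, ∫ x, (u (momentumFlip i x) - u x) ^ 2 ∂((pinnedChain ω₂ lam β γ).gibbsMeasure L T) ≤
      ∫ x, u x * J x ∂((pinnedChain ω₂ lam β γ).gibbsMeasure L T) := by
  set P := pinnedChain ω₂ lam β γ with hP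
  set μ := P.gibbsMeasure L T with hμ
  set B := OscillatorChain.bathWeight L with hB
  have hflip := gibbs_flipInvariant (ω₂ := ω₂) (lam := lam) (β := β) (γ := γ) L T
  have hB0 : ∀ i, 0 ≤ B i := Literature.MathematicalPhysics.KineticTheory.HeatConduction.bathWeight_nonneg L
  have hSu2 : MemLp (flipNoise L u) 2 μ := memLp_flipNoise hflip hu2
  set kf : PhaseSpace L → ℝ := fun x => (J x - s * u x) + ε * flipNoise L u x with hkf
  have hkf2 : MemLp kf 2 μ := (hJ2.sub (hu2.const_mul s)).add (hSu2.const_mul ε)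
  have hpair : ∀ x, 1 * liouvilleOp P L u x + γ * bathOp L B T u x = -kf x := fun x =>
    flip_forwardPair (ω₂ := ω₂) (lam := lam) (β := β) (γ := γ) L T ε (k := fun y => J y - s * u y)
      (fun y => by
        show P.flipGenerator L T T ε u y = -(J y - s * u y)
        rw [hpde y]
        ring) x
  have hFD := fluctuation_dissipation hω hl.le hβ.le L hT B hB0 1 hγ huC hu2 hkf2 hpair
  have hρ0 : 0 ≤ ∫ x, u x * kf x * P.gibbsDensity L T x := by
    rw [hFD]
    refine mul_nonneg (mul_nonneg hγ.le hT.le) (Finset.sum_nonneg fun i _ => mul_nonneg (hB0 i) ?_)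
    exact integral_nonneg fun x => mul_nonneg (sq_nonneg _) (P.gibbsDensity_pos L T x).le
  have hμ0 : 0 ≤ ∫ x, u x * kf x ∂μ := by
    rw [P.integral_gibbsMeasure]
    exact mul_nonneg (inv_nonneg.2 (integral_nonneg fun x => (P.gibbsDensity_pos L T x).le)) hρ0
  have i1 : Integrable (fun x => u x * J x) μ := hu2.integrable_mul hJ2
  have i2 : Integrable (fun x => u x ^ 2) μ := hu2.integrable_sq
  have i3 : Integrable (fun x => u x * flipNoise L u x) μ := hu2.integrable_mul hSu2
  have e : (fun x => u x * kf x) = fun x => u x * J x - s * u x ^ 2 + ε * (u x * flipNoise L u x) := by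
    funext x
    simp only [hkf]
    ring
  have i2' : Integrable (fun x => s * u x ^ 2) μ := i2.const_mul s
  have i12 : Integrable (fun x => u x * J x - s * u x ^ 2) μ := i1.sub i2'
  have i3' : Integrable (fun x => ε * (u x * flipNoise L u x)) μ := i3.const_mul ε
  rw [e, integral_add i12 i3', integral_sub i1 i2', integral_const_mul, integral_const_mul,
    integral_mul_flipNoise_self hflip hu2] at hμ0
  linarith

/-- **Uniform bound on the flip Dirichlet energy of an Abel corrector**: for `s ≥ 0`, `ε > 0` and half-current
second moments `≤ M₁`, `Σ_i ‖u∘F_i − u‖²_{L²(μ_T)} ≤ L M₁/ε²` (energy inequality + sector bound with `δ = ε`).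
[cite: BernardinOlla2011, §3] -/
theorem corrector_flipEnergy_le (hω : 0 < ω₂) (hl : 0 < lam) (hβ : 0 < β) (hγ : 0 < γ) {T : ℝ} (hT : 0 < T)
    {ε : ℝ} (hε : 0 < ε) {L : ℕ} {s : ℝ} (hs : 0 ≤ s) {u : PhaseSpace L → ℝ} (huC : ContDiff ℝ 2 u)
    (hu2 : MemLp u 2 ((pinnedChain ω₂ lam β γ).gibbsMeasure L T))
    (hpde : ∀ x, (pinnedChain ω₂ lam β γ).flipGenerator L T T ε u x =
      s * u x - ∑ i, (pinnedChain ω₂ lam β γ).bondCurrent L i x)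
    {M₁ : ℝ} (hM : ∀ k i j : Fin L,
      MemLp (fun x : PhaseSpace L => x.2 k * deriv (pinnedChain ω₂ lam β γ).V (x.1 j - x.1 i)) 2
          ((pinnedChain ω₂ lam β γ).gibbsMeasure L T) ∧
        ∫ x, (x.2 k * deriv (pinnedChain ω₂ lam β γ).V (x.1 j - x.1 i)) ^ 2
          ∂((pinnedChain ω₂ lam β γ).gibbsMeasure L T) ≤ M₁) :
    ∑ i, ∫ x, (u (momentumFlip i x) - u x) ^ 2 ∂((pinnedChain ω₂ lam β γ).gibbsMeasure L T) ≤
      L * M₁ / ε ^ 2 := by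
  have hflip := gibbs_flipInvariant (ω₂ := ω₂) (lam := lam) (β := β) (γ := γ) L T
  have hE := corrector_energy_le hω hl hβ hγ hT ε (memLp_totalCurrent hω hl.le hβ.le γ L hT) huC hu2 hpde
  have hC := abs_integral_mul_totalCurrent_le (pinnedChain ω₂ lam β γ) hflip hM hu2 hε
  have h0 : 0 ≤ s * ∫ x, u x ^ 2 ∂((pinnedChain ω₂ lam β γ).gibbsMeasure L T) :=
    mul_nonneg hs (integral_nonneg fun x => sq_nonneg _)
  have h1 := le_abs_self
    (∫ x, u x * (∑ i, (pinnedChain ω₂ lam β γ).bondCurrent L i x) ∂((pinnedChain ω₂ lam β γ).gibbsMeasure L T))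
  set E := ∑ i, ∫ x, (u (momentumFlip i x) - u x) ^ 2 ∂((pinnedChain ω₂ lam β γ).gibbsMeasure L T) with hEdef
  have h2 : ε * E ≤ L * M₁ / ε := by linarith
  rw [le_div_iff₀ hε] at h2
  rw [le_div_iff₀ (by positivity)]
  nlinarith [h2]

/-- **Resolvent identity.** For classical correctors `u` at `s` and `u'` at `s'` with a common source `J ∈ L²(μ_T)`
odd under the momentum reversal: `∫ J u dμ_T − ∫ J u' dμ_T = (s − s') ∫ u · (u'∘Π) dμ_T`. Proof: the cross
Green identity (`Kubo.cross`) for the forward pair `(u, (J − su) + εSu)` against the backward pair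
`(rev u', rev((J − s'u') + εSu'))` (`Kubo.rev_pair`); the flip terms cancel by symmetry of `S`
(`integral_mul_flipNoise`, `flipNoise_rev`), and `∫ (rev u') J = −∫ u' J` by reversal invariance of `μ_T`.
[cite: BernardinOlla2011, §5] -/
theorem resolvent_identity (hω : 0 < ω₂) (hl : 0 < lam) (hβ : 0 < β) (hγ : 0 < γ) {T : ℝ} (hT : 0 < T)
    (ε : ℝ) {L : ℕ} {s s' : ℝ} {u u' J : PhaseSpace L → ℝ}
    (hJ2 : MemLp J 2 ((pinnedChain ω₂ lam β γ).gibbsMeasure L T)) (hJodd : ∀ x, J (x.1, -x.2) = -J x)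
    (huC : ContDiff ℝ 2 u) (hu2 : MemLp u 2 ((pinnedChain ω₂ lam β γ).gibbsMeasure L T))
    (hpde : ∀ x, (pinnedChain ω₂ lam β γ).flipGenerator L T T ε u x = s * u x - J x)
    (hu'C : ContDiff ℝ 2 u') (hu'2 : MemLp u' 2 ((pinnedChain ω₂ lam β γ).gibbsMeasure L T))
    (hpde' : ∀ x, (pinnedChain ω₂ lam β γ).flipGenerator L T T ε u' x = s' * u' x - J x) :
    (∫ x, J x * u x ∂((pinnedChain ω₂ lam β γ).gibbsMeasure L T)) -
        ∫ x, J x * u' x ∂((pinnedChain ω₂ lam β γ).gibbsMeasure L T) =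
      (s - s') * ∫ x, u x * u' (x.1, -x.2) ∂((pinnedChain ω₂ lam β γ).gibbsMeasure L T) := by
  set P := pinnedChain ω₂ lam β γ with hP
  set μ := P.gibbsMeasure L T with hμ
  set B := OscillatorChain.bathWeight L with hB
  have hflip := gibbs_flipInvariant (ω₂ := ω₂) (lam := lam) (β := β) (γ := γ) L T
  have hB0 : ∀ i, 0 ≤ B i := Literature.MathematicalPhysics.KineticTheory.HeatConduction.bathWeight_nonneg L
  have hSu2 : MemLp (flipNoise L u) 2 μ := memLp_flipNoise hflip hu2
  have hSu'2 : MemLp (flipNoise L u') 2 μ := memLp_flipNoise hflip hu'2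
  -- the two forward pairs
  set kf : PhaseSpace L → ℝ := fun x => (J x - s * u x) + ε * flipNoise L u x with hkf
  set kf' : PhaseSpace L → ℝ := fun x => (J x - s' * u' x) + ε * flipNoise L u' x with hkf'
  have hkf2 : MemLp kf 2 μ := (hJ2.sub (hu2.const_mul s)).add (hSu2.const_mul ε)
  have hkf'2 : MemLp kf' 2 μ := (hJ2.sub (hu'2.const_mul s')).add (hSu'2.const_mul ε)
  have hpu : ∀ x, 1 * liouvilleOp P L u x + γ * bathOp L B T u x = -kf x := fun x =>
    flip_forwardPair (ω₂ := ω₂) (lam := lam) (β := β) (γ := γ) L T ε (k := fun y => J y - s * u y)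
      (fun y => by
        show P.flipGenerator L T T ε u y = -(J y - s * u y)
        rw [hpde y]
        ring) x
  have hpu' : ∀ x, 1 * liouvilleOp P L u' x + γ * bathOp L B T u' x = -kf' x := fun x =>
    flip_forwardPair (ω₂ := ω₂) (lam := lam) (β := β) (γ := γ) L T ε (k := fun y => J y - s' * u' y)
      (fun y => by
        show P.flipGenerator L T T ε u' y = -(J y - s' * u' y)
        rw [hpde' y]
        ring) x
  -- the reversed corrector is a backward pair
  have hph : ∀ x, -1 * liouvilleOp P L (rev u') x + γ * bathOp L B T (rev u') x = -rev kf' x :=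
    rev_pair P B T 1 γ hpu'
  have hru'C : ContDiff ℝ 2 (rev u') := contDiff_rev hu'C
  have hru'2 : MemLp (rev u') 2 μ := memLp_rev hω hl.le hβ.le L hT hu'C.continuous hu'2
  have hkf'c : Continuous kf' := continuous_source B T 1 γ hu'C hpu'
  have hrkf'2 : MemLp (rev kf') 2 μ := memLp_rev hω hl.le hβ.le L hT hkf'c hkf'2
  -- the cross Green identity, in Gibbs-measure form
  have hρ := cross hω hl.le hβ.le L hT B hB0 1 hγ huC hru'C hu2 hru'2 hkf2 hrkf'2 hpu hph
  have hμeq : ∫ x, rev u' x * kf x ∂μ = ∫ x, u x * rev kf' x ∂μ := by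
    rw [P.integral_gibbsMeasure, P.integral_gibbsMeasure, hρ]
  -- the left-hand side
  have hL1 : ∫ x, rev u' x * kf x ∂μ = -(∫ x, J x * u' x ∂μ) - s * (∫ x, u x * u' (x.1, -x.2) ∂μ) +
      ε * ∫ x, rev u' x * flipNoise L u x ∂μ := by
    have i1 : Integrable (fun x => rev u' x * J x) μ := hru'2.integrable_mul hJ2
    have i2 : Integrable (fun x => u x * u' (x.1, -x.2)) μ := hu2.integrable_mul hru'2
    have i3 : Integrable (fun x => rev u' x * flipNoise L u x) μ := hru'2.integrable_mul hSu2
    have e : (fun x => rev u' x * kf x) =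
        fun x => rev u' x * J x - s * (u x * u' (x.1, -x.2)) + ε * (rev u' x * flipNoise L u x) := by
      funext x
      simp only [hkf, rev_apply]
      ring
    have hr : ∫ x, rev u' x * J x ∂μ = -∫ x, J x * u' x ∂μ := by
      rw [← integral_neg]
      have h := integral_rev_gibbsMeasure P T (fun x => -(J x * u' x))
      refine Eq.trans (integral_congr_ae (ae_of_all _ fun x => ?_)) h
      simp only [rev_apply, hJodd x]
      ring
    have i2' : Integrable (fun x => s * (u x * u' (x.1, -x.2))) μ := i2.const_mul s
    have i12 : Integrable (fun x => rev u' x * J x - s * (u x * u' (x.1, -x.2))) μ := i1.sub i2'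
    have i3' : Integrable (fun x => ε * (rev u' x * flipNoise L u x)) μ := i3.const_mul ε
    rw [e, integral_add i12 i3', integral_sub i1 i2', integral_const_mul, integral_const_mul, hr]
  -- the right-hand side
  have hR1 : ∫ x, u x * rev kf' x ∂μ = -(∫ x, J x * u x ∂μ) - s' * (∫ x, u x * u' (x.1, -x.2) ∂μ) +
      ε * ∫ x, u x * flipNoise L (rev u') x ∂μ := by
    have hSru'2 : MemLp (flipNoise L (rev u')) 2 μ := memLp_flipNoise hflip hru'2
    have i1 : Integrable (fun x => J x * u x) μ := hJ2.integrable_mul hu2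
    have i2 : Integrable (fun x => u x * u' (x.1, -x.2)) μ := hu2.integrable_mul hru'2
    have i3 : Integrable (fun x => u x * flipNoise L (rev u') x) μ := hu2.integrable_mul hSru'2
    have e : (fun x => u x * rev kf' x) =
        fun x => -(J x * u x) - s' * (u x * u' (x.1, -x.2)) + ε * (u x * flipNoise L (rev u') x) := by
      funext x
      rw [flipNoise_rev u' x]
      simp only [hkf', rev_apply, hJodd x]
      ring
    have i1' : Integrable (fun x => -(J x * u x)) μ := i1.neg
    have i2' : Integrable (fun x => s' * (u x * u' (x.1, -x.2))) μ := i2.const_mul s'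
    have i12 : Integrable (fun x => -(J x * u x) - s' * (u x * u' (x.1, -x.2))) μ := i1'.sub i2'
    have i3' : Integrable (fun x => ε * (u x * flipNoise L (rev u') x)) μ := i3.const_mul ε
    rw [e, integral_add i12 i3', integral_sub i1' i2', integral_neg, integral_const_mul, integral_const_mul]
  -- `S` is symmetric under `μ_T`
  have hS : ∫ x, rev u' x * flipNoise L u x ∂μ = ∫ x, u x * flipNoise L (rev u') x ∂μ := by
    have hgi : ∀ i, MemLp (fun x => u (momentumFlip i x)) 2 μ := memLp_comp_momentumFlip hflip hu2
    rw [integral_mul_flipNoise hflip (hru'2.integrable_mul hu2) (fun i => hru'2.integrable_mul (hgi i))]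
    exact integral_congr_ae (ae_of_all _ fun x => mul_comm _ _)
  rw [hL1, hR1, hS] at hμeq
  linarith

/-- **The Abel transfer** (nice form of the registered stub): the flip sector gap (hypothesis `hGap`) and a
Kapitza bound with constant `M` (hypothesis `hKap`) give `C = 4 max(M, 0) + M₁/ε²` (`M₁` the uniform
half-current moment bound) with `|∫ J u dμ_T − ∫ J u' dμ_T| ≤ C (L − 1)|s − s'|` for all `L ≥ 2`, `s, s' ∈ (0,1]`
and classical Abel correctors `u` at `s`, `u'` at `s'`. [cite: BernardinOlla2011, §5] -/
theorem abelTransfer (hω : 0 < ω₂) (hl : 0 < lam) (hβ : 0 < β) (hγ : 0 < γ) {T : ℝ} (hT : 0 < T) {ε : ℝ}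
    (hε : 0 < ε) (M : ℝ)
    (hGap : ∀ (L : ℕ), 2 ≤ L → ∀ u : PhaseSpace L → ℝ, MemLp u 2 ((pinnedChain ω₂ lam β γ).gibbsMeasure L T) →
      4 * ∫ x, (u x - (∑ w : Fin L → Bool, u (x.1, fun i => if w i then -x.2 i else x.2 i)) / 2 ^ L) ^ 2
          ∂((pinnedChain ω₂ lam β γ).gibbsMeasure L T) ≤
        ∑ i : Fin L, ∫ x, (u (momentumFlip i x) - u x) ^ 2 ∂((pinnedChain ω₂ lam β γ).gibbsMeasure L T))
    (hKap : ∀ (L : ℕ), 2 ≤ L → ∀ s : ℝ, 0 < s → s ≤ 1 → ∀ u : PhaseSpace L → ℝ,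
      (ContDiff ℝ 2 u ∧ MemLp u 2 ((pinnedChain ω₂ lam β γ).gibbsMeasure L T) ∧
        ∀ x, (pinnedChain ω₂ lam β γ).flipGenerator L T T ε u x =
          s * u x - ∑ i : Fin L, (pinnedChain ω₂ lam β γ).bondCurrent L i x) →
      ∫ x, ((∑ w : Fin L → Bool, u (x.1, fun i => if w i then -x.2 i else x.2 i)) / 2 ^ L) ^ 2
        ∂((pinnedChain ω₂ lam β γ).gibbsMeasure L T) ≤ M * L) :
    ∃ C : ℝ, ∀ (L : ℕ), 2 ≤ L → ∀ s s' : ℝ, 0 < s → s ≤ 1 → 0 < s' → s' ≤ 1 → ∀ u u' : PhaseSpace L → ℝ,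
      (ContDiff ℝ 2 u ∧ MemLp u 2 ((pinnedChain ω₂ lam β γ).gibbsMeasure L T) ∧
        ∀ x, (pinnedChain ω₂ lam β γ).flipGenerator L T T ε u x =
          s * u x - ∑ i : Fin L, (pinnedChain ω₂ lam β γ).bondCurrent L i x) →
      (ContDiff ℝ 2 u' ∧ MemLp u' 2 ((pinnedChain ω₂ lam β γ).gibbsMeasure L T) ∧
        ∀ x, (pinnedChain ω₂ lam β γ).flipGenerator L T T ε u' x =
          s' * u' x - ∑ i : Fin L, (pinnedChain ω₂ lam β γ).bondCurrent L i x) →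
      |(∫ x, (∑ i : Fin L, (pinnedChain ω₂ lam β γ).bondCurrent L i x) * u x
            ∂((pinnedChain ω₂ lam β γ).gibbsMeasure L T)) -
          ∫ x, (∑ i : Fin L, (pinnedChain ω₂ lam β γ).bondCurrent L i x) * u' x
            ∂((pinnedChain ω₂ lam β γ).gibbsMeasure L T)| ≤ C * ((L : ℝ) - 1) * |s - s'| := by
  obtain ⟨M₁, hM₁⟩ := gibbsHalfCurrentSqLe (ω₂ := ω₂) (lam := lam) (β := β) hω hl.le hβ.le γ hT
  have hM₁0 : 0 ≤ M₁ := (integral_nonneg fun x => sq_nonneg _).trans (hM₁ 1 0 0 0).2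
  refine ⟨4 * max M 0 + M₁ / ε ^ 2, fun L hL s s' hs hs1 hs' hs'1 u u' hu hu' => ?_⟩
  obtain ⟨huC, hu2, hupde⟩ := hu
  obtain ⟨hu'C, hu'2, hu'pde⟩ := hu'
  set P := pinnedChain ω₂ lam β γ with hP
  set μ := P.gibbsMeasure L T with hμ
  have hflip := gibbs_flipInvariant (ω₂ := ω₂) (lam := lam) (β := β) (γ := γ) L T
  have hJ2 : MemLp (fun x => ∑ i, P.bondCurrent L i x) 2 μ := memLp_totalCurrent hω hl.le hβ.le γ L hT
  have hJodd : ∀ x : PhaseSpace L, (∑ i, P.bondCurrent L i ((x.1, -x.2) : PhaseSpace L)) =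
      -∑ i, P.bondCurrent L i x := totalCurrent_neg_momentum P
  -- Step 1: the resolvent identity
  have hres : (∫ x, (∑ i, P.bondCurrent L i x) * u x ∂μ) - ∫ x, (∑ i, P.bondCurrent L i x) * u' x ∂μ =
      (s - s') * ∫ x, u x * u' (x.1, -x.2) ∂μ :=
    resolvent_identity hω hl hβ hγ hT ε hJ2 hJodd huC hu2 hupde hu'C hu'2 hu'pde
  -- Step 2: the flip Dirichlet energies are `O(L)`
  have hM : ∀ k i j : Fin L, MemLp (fun x : PhaseSpace L => x.2 k * deriv P.V (x.1 j - x.1 i)) 2 μ ∧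
      ∫ x, (x.2 k * deriv P.V (x.1 j - x.1 i)) ^ 2 ∂μ ≤ M₁ := fun k i j => hM₁ L k i j
  have hEu : ∑ i, ∫ x, (u (momentumFlip i x) - u x) ^ 2 ∂μ ≤ L * M₁ / ε ^ 2 :=
    corrector_flipEnergy_le hω hl hβ hγ hT hε hs.le huC hu2 hupde hM
  have hEu' : ∑ i, ∫ x, (u' (momentumFlip i x) - u' x) ^ 2 ∂μ ≤ L * M₁ / ε ^ 2 :=
    corrector_flipEnergy_le hω hl hβ hγ hT hε hs'.le hu'C hu'2 hu'pde hM
  -- Step 3: `‖u‖², ‖u'‖² ≤ 2ML + E/2`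
  have hNu : ∫ x, u x ^ 2 ∂μ ≤ 2 * (M * L) + (∑ i, ∫ x, (u (momentumFlip i x) - u x) ^ 2 ∂μ) / 2 :=
    integral_sq_le_of_split hu2 (memLp_patternAverage hflip hu2) (hGap L hL u hu2)
      (hKap L hL s hs hs1 u ⟨huC, hu2, hupde⟩)
  have hNu' : ∫ x, u' x ^ 2 ∂μ ≤ 2 * (M * L) + (∑ i, ∫ x, (u' (momentumFlip i x) - u' x) ^ 2 ∂μ) / 2 :=
    integral_sq_le_of_split hu'2 (memLp_patternAverage hflip hu'2) (hGap L hL u' hu'2)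
      (hKap L hL s' hs' hs'1 u' ⟨hu'C, hu'2, hu'pde⟩)
  -- Step 4: Cauchy–Schwarz for `∫ u (u'∘Π)`
  have hru'2 : MemLp (rev u') 2 μ := memLp_rev hω hl.le hβ.le L hT hu'C.continuous hu'2
  have hX2 : (∫ x, u x * u' (x.1, -x.2) ∂μ) ^ 2 ≤ (∫ x, u x ^ 2 ∂μ) * ∫ x, u' (x.1, -x.2) ^ 2 ∂μ :=
    sq_integral_mul_le hu2 hru'2
  have hrev : ∫ x, u' (x.1, -x.2) ^ 2 ∂μ = ∫ x, u' x ^ 2 ∂μ := integral_rev_gibbsMeasure P T (fun x => u' x ^ 2)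
  -- arithmetic
  have hL2 : (2 : ℝ) ≤ L := by exact_mod_cast hL
  have hML : M * L ≤ max M 0 * L := mul_le_mul_of_nonneg_right (le_max_left _ _) (by linarith)
  have hmax : 0 ≤ max M 0 := le_max_right _ _
  set K : ℝ := 2 * (max M 0 * L) + L * M₁ / ε ^ 2 / 2 with hK
  have hK0 : 0 ≤ K := by positivity
  have ha : ∫ x, u x ^ 2 ∂μ ≤ K := by linarith
  have hb : ∫ x, u' x ^ 2 ∂μ ≤ K := by linarith
  have hb0 : 0 ≤ ∫ x, u' (x.1, -x.2) ^ 2 ∂μ := integral_nonneg fun x => sq_nonneg _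
  have hXK : |∫ x, u x * u' (x.1, -x.2) ∂μ| ≤ K := by
    refine abs_le_of_sq_le_sq ?_ hK0
    calc (∫ x, u x * u' (x.1, -x.2) ∂μ) ^ 2 ≤ (∫ x, u x ^ 2 ∂μ) * ∫ x, u' (x.1, -x.2) ^ 2 ∂μ := hX2
      _ ≤ K * K := mul_le_mul ha (hrev ▸ hb) hb0 hK0
      _ = K ^ 2 := (sq K).symm
  have hKC : K ≤ (4 * max M 0 + M₁ / ε ^ 2) * ((L : ℝ) - 1) := by
    have hc : 0 ≤ 2 * max M 0 + M₁ / ε ^ 2 / 2 := by positivity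
    have e1 : K = (L : ℝ) * (2 * max M 0 + M₁ / ε ^ 2 / 2) := by
      simp only [hK]
      ring
    have e2 : (4 * max M 0 + M₁ / ε ^ 2) * ((L : ℝ) - 1) =
        (2 * ((L : ℝ) - 1)) * (2 * max M 0 + M₁ / ε ^ 2 / 2) := by ring
    rw [e1, e2]
    exact mul_le_mul_of_nonneg_right (by linarith) hc
  rw [hres, abs_mul]
  calc |s - s'| * |∫ x, u x * u' (x.1, -x.2) ∂μ|
      ≤ |s - s'| * ((4 * max M 0 + M₁ / ε ^ 2) * ((L : ℝ) - 1)) :=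
        mul_le_mul_of_nonneg_left (hXK.trans hKC) (abs_nonneg _)
    _ = (4 * max M 0 + M₁ / ε ^ 2) * ((L : ℝ) - 1) * |s - s'| := by ring

end Chain

end AbelTransfer

/-! ## The registered stub -/

/-- STUB A6b — **THE ABEL TRANSFER** (line `abel-kapitza-even-corrector`, crux stmt-AtomisticToContinuum-11977):
the flip sector gap and a Kapitza bound with constant `M` give an `L`-uniform Lipschitz bound of the Green–Kubo
pairing in the Abel variable on `(0,1]`: `|∫ J_L u dμ_T − ∫ J_L u' dμ_T| ≤ C(L−1)|s − s'|` for classical Abel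
correctors `u` at `s`, `u'` at `s'` (`AbelTransfer.abelTransfer`, notation-free restatement).
[cite: BernardinOlla2011, §5] -/
theorem stub_abelTransfer :
    ∀ (ω₂ lam β γ T ε : ℝ), 0 < ω₂ → 0 < lam → 0 < β → 0 < γ → 0 < T → 0 < ε → ∀ M : ℝ, (∀ (L : ℕ), 2 ≤ L → ∀ u : Literature.MathematicalPhysics.KineticTheory.HeatConduction.PhaseSpace L → ℝ, MeasureTheory.MemLp u 2 ((Literature.MathematicalPhysics.KineticTheory.HeatConduction.pinnedChain ω₂ lam β γ).gibbsMeasure L T) → 4 * MeasureTheory.integral ((Literature.MathematicalPhysics.KineticTheory.HeatConduction.pinnedChain ω₂ lam β γ).gibbsMeasure L T) (fun x => (u x - (∑ w : Fin L → Bool, u (x.1, fun i => if w i then -x.2 i else x.2 i)) / 2 ^ L) ^ 2) ≤ ∑ i : Fin L, MeasureTheory.integral ((Literature.MathematicalPhysics.KineticTheory.HeatConduction.pinnedChain ω₂ lam β γ).gibbsMeasure L T) (fun x => (u (Literature.MathematicalPhysics.KineticTheory.HeatConduction.momentumFlip i x) - u x) ^ 2)) → (∀ (L : ℕ), 2 ≤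 L → ∀ s : ℝ, 0 < s → s ≤ 1 → ∀ u : Literature.MathematicalPhysics.KineticTheory.HeatConduction.PhaseSpace L → ℝ, (ContDiff ℝ 2 u ∧ MeasureTheory.MemLp u 2 ((Literature.MathematicalPhysics.KineticTheory.HeatConduction.pinnedChain ω₂ lam β γ).gibbsMeasure L T) ∧ ∀ x, (Literature.MathematicalPhysics.KineticTheory.HeatConduction.pinnedChain ω₂ lam β γ).flipGenerator L T T ε u x = s * u x - ∑ i : Fin L, (Literature.MathematicalPhysics.KineticTheory.HeatConduction.pinnedChain ω₂ lam β γ).bondCurrent L i x) → MeasureTheory.integral ((Literature.MathematicalPhysics.KineticTheory.HeatConduction.pinnedChain ω₂ lam β γ).gibbsMeasure L T) (fun x => ((∑ w : Fin L → Bool, u (x.1, fun i => if w i then -x.2 i else x.2 i)) / 2 ^ L) ^ 2) ≤ M * L) → ∃ C : ℝ, ∀ (L : ℕ), 2 ≤ L → ∀ s s' : ℝ, 0 < s → s ≤ 1 → 0 < s' → s' ≤ 1 → ∀ u u' : Literature.MathematicalPhysics.KineticTheory.HeatConduction.PhaseSpace L → ℝ, (ContDiff ℝ 2 u ∧ MeasureTheory.MemLp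 u 2 ((Literature.MathematicalPhysics.KineticTheory.HeatConduction.pinnedChain ω₂ lam β γ).gibbsMeasure L T) ∧ ∀ x, (Literature.MathematicalPhysics.KineticTheory.HeatConduction.pinnedChain ω₂ lam β γ).flipGenerator L T T ε u x = s * u x - ∑ i : Fin L, (Literature.MathematicalPhysics.KineticTheory.HeatConduction.pinnedChain ω₂ lam β γ).bondCurrent L i x) → (ContDiff ℝ 2 u' ∧ MeasureTheory.MemLp u' 2 ((Literature.MathematicalPhysics.KineticTheory.HeatConduction.pinnedChain ω₂ lam β γ).gibbsMeasure L T) ∧ ∀ x, (Literature.MathematicalPhysics.KineticTheory.HeatConduction.pinnedChain ω₂ lam β γ).flipGenerator L T T ε u' x = s' * u' x - ∑ i : Fin L, (Literature.MathematicalPhysics.KineticTheory.HeatConduction.pinnedChain ω₂ lam β γ).bondCurrent L i x) → |(MeasureTheory.integral ((Literature.MathematicalPhysics.KineticTheory.HeatConduction.pinnedChain ω₂ lam β γ).gibbsMeasure L T) (fun x => (∑ i : Fin L, (Literature.MathematicalPhysics.KineticTheory.HeatConduction.pinnedChain ω₂ lam β γ).bondCurrent L i x) * u x)) - MeasureTheory.integral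 ((Literature.MathematicalPhysics.KineticTheory.HeatConduction.pinnedChain ω₂ lam β γ).gibbsMeasure L T) (fun x => (∑ i : Fin L, (Literature.MathematicalPhysics.KineticTheory.HeatConduction.pinnedChain ω₂ lam β γ).bondCurrent L i x) * u' x)| ≤ C * ((L : ℝ) - 1) * |s - s'| :=
  fun _ _ _ _ _ _ hω hl hβ hγ hT hε M hGap hKap => AbelTransfer.abelTransfer hω hl hβ hγ hT hε M hGap hKap

end Summit.AtomisticToContinuum.FouriersLaw.Cruxes.NoisyFourier.AbelKapitzaEvenCorrector

end
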